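import Literature.AlgebraicGeometry.Modules.CechProductCoverLexSystem
import HarnessLib

/-!
# The Künneth carrier on the product cover: `Č(lexSystem (Č-systems of 𝓤, 𝓥 tensored)) ≅ Č(W₀, E ⊠ F)`
# (The Stacks Project, Tag 0BEC: the Čech complex of the product covering; Görtz–Wedhorn I Cor. 7.19 (4), Prop. 7.24 (2))

Layer `Literature/AlgebraicGeometry/Modules`, namespace `Literature.AlgebraicGeometry.Modules`.  THEOREMS ONLY (no definition, no named
fact, no instance, no notation, no `sorry`).  Cell `hodgecm-mathlib` (D-0151), F-11 ∕ J3 Künneth packet, (G3)∕(iv-4) BRIDGE piece (B-i),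
TENSOR HALF (B-p06 (g15); consumers B-p21 (g21)'s (G3) assembly `CechProductCoverKunnethComponents`, F0P1b-p04 (g0), F0P1b-p02 (g2)).

SETTING = the binder block of ★ `Modules/CechBoxTensorBicomplex` ∕ ★ `Modules/BoxTensorAffineSectionsSecMod`: an AFFINE base `S` with
`φ : A ≃+* Γ(S, ⊤)`, a cartesian square `H : IsPullback p q iX iY` (`Z = X ×_S Y`), finite linearly ordered families `𝓤 : ι → X.Opens`,
`𝓥 : κ → Y.Opens` with AFFINE non-empty finite intersections (`hU`, `hV`), quasi-coherent (affine-localizing) `E`, `F` (`hE`, `hF`); rings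
`overRingHom iX φ`, `overRingHom iY φ`, `overRingHom (p ≫ iX) φ`.  The PRODUCT COVER is `W₀ (i, j) := p⁻¹U_i ∩ q⁻¹V_j` on `ι ×ₗ κ`.

* **`exists_sysComplex_lexSystem_prodSystem_iso_cechComplex`** — an isomorphism of cochain complexes of `A`-modules
  `Č(lexSystem (Γ(𝓤, E) ⊠ Γ(𝓥, F))) ≅ Č(W₀, E ⊠ F)` (the source is the carrier of ★ F0P1b-p06's `nonempty_homologyIso_total_lexSystem` ∘ ★
  `cechTensorIsoTotal`, i.e. of the Künneth comparison `Č(𝓤,E) ⊗ Č(𝓥,F) → …`; the target is the module Čech complex of the product cover, on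
  which cup products and the pull-backs `p^*`, `q^*` live), CHARACTERISED on every simplex `σ` of `ι ×ₗ κ`: the component is the affine sections
  isomorphism ★ `boxTensorSecModEquiv⁻¹ : Γ(U_{π₁σ}, E) ⊗_A Γ(V_{π₂σ}, F) ≅ Γ(p⁻¹U_{π₁σ} ∩ q⁻¹V_{π₂σ}, E ⊠ F)` followed by the restriction along
  ★ `cechOpen_prodCover_eq` (`⋂_{(i,j)∈σ} W₀(i,j) = p⁻¹U_{π₁σ} ∩ q⁻¹V_{π₂σ}`); on pure tensors `a ⊗ b ↦ (η_p a)| · (η_q b)|` (★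
  `boxTensorSecModEquiv_symm_tmul`).  Built by ★ `OrderedCech.sysComplexIsoNE` (values at `∅` never enter the ordered complex) from the
  components on NON-EMPTY chains, natural by ★ `boxTensorSecModEquiv_natural`.

HC_CM is proved only modulo the 7 printed citations until rung 0 closes; pure scheme-theoretic bookkeeping.

## References
* [StacksProject] The Stacks Project, Tag 0BEC (Künneth formula: the Čech complex of the product covering), Tag 01FG.
* [GortzWedhorn2020] U. Görtz, T. Wedhorn, *Algebraic Geometry I*, 2nd ed. (2020), Cor. 7.19 (4) and Prop. 7.24 (2), Rem. 7.25.
* [GortzWedhorn2023] U. Görtz, T. Wedhorn, *Algebraic Geometry II* (2023), Def. 21.64 (p. 179), Def. 21.68 (p. 180).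
-/

set_option backward.isDefEq.respectTransparency false -- `Scheme.Modules` is not reducible (as in ★ `CechBoxTensorBicomplex`)

noncomputable section

universe u

open CategoryTheory AlgebraicGeometry TopologicalSpace TensorProduct MonoidalCategory
open Literature.Algebra.Homology Literature.Algebra.Homology.OrderedCech

namespace Literature.AlgebraicGeometry.Modules

variable {X Y Z S : Scheme.{u}} {p : Z ⟶ X} {q : Z ⟶ Y} {iX : X ⟶ S} {iY : Y ⟶ S} {A : Type u} [CommRing A]
  {ι κ : Type} [LinearOrder ι] [LinearOrder κ] (𝓤 : ι → X.Opens) (𝓥 : κ → Y.Opens) {E : X.Modules} {F : Y.Modules}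
  [IsAffine S] (H : IsPullback p q iX iY) (hU : ∀ s : Finset ι, s.Nonempty → IsAffineOpen (cechOpen 𝓤 s))
  (hV : ∀ t : Finset κ, t.Nonempty → IsAffineOpen (cechOpen 𝓥 t)) (hE : IsAffineLocalizing E) (hF : IsAffineLocalizing F)
  (φ : A ≃+* Γ(S, ⊤))

omit [LinearOrder ι] [LinearOrder κ] in
/-- Naturality of `boxTensorSecModEquiv⁻¹` in BOTH variables at once (from ★ `boxTensorSecModEquiv_natural`).
[cite: GortzWedhorn2020, Rem. 7.25] [cite: StacksProject, Tag 0BEC] -/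
theorem boxTensorSecModEquiv_symm_natural {s s' : Finset ι} {t t' : Finset κ} (hs : s.Nonempty) (hs' : s'.Nonempty)
    (ht : t.Nonempty) (ht' : t'.Nonempty) (h₁ : s ⊆ s') (h₂ : t ⊆ t')
    (x : SecMod E (overRingHom iX φ) (cechOpen 𝓤 s) ⊗[A] SecMod F (overRingHom iY φ) (cechOpen 𝓥 t)) :
    (boxTensorSecModEquiv H (hU s' hs') (hV t' ht') rfl hE hF φ).symm
        (TensorProduct.map (SecMod.res E _ (cechOpen_anti 𝓤 h₁)) (SecMod.res F _ (cechOpen_anti 𝓥 h₂)) x) =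
      SecMod.res (boxTensor p q E F) (overRingHom (p ≫ iX) φ) (boxOpen_anti p q 𝓤 𝓥 h₁ h₂)
        ((boxTensorSecModEquiv H (hU s hs) (hV t ht) rfl hE hF φ).symm x) := by
  rw [LinearEquiv.symm_apply_eq, boxTensorSecModEquiv_natural H (hU s hs) (hV t ht) (hU s' hs') (hV t' ht') rfl rfl
    hE hF φ (cechOpen_anti 𝓤 h₁) (cechOpen_anti 𝓥 h₂) _, LinearEquiv.apply_symm_apply]

/-- **`Č(lexSystem (Γ(𝓤,E) ⊠ Γ(𝓥,F))) ≅ Č(W₀, E ⊠ F)`, CHARACTERISED** — the Künneth carrier (lexicographic system of the tensored Čech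
systems, ★ `OrderedCechLexSystem` ∕ `CechBoxTensorBicomplex`) IS the module Čech complex of the product cover `W₀ (i,j) = p⁻¹U_i ∩ q⁻¹V_j`
with coefficients in `E ⊠ F`, for an affine base, affine finite intersections and quasi-coherent `E`, `F`; on every simplex `σ` the component is
`resᵉ ∘ boxTensorSecModEquiv⁻¹` (affine Künneth in degree `0`, then the restriction along `cechOpen_prodCover_eq`), so on pure tensors
`a ⊗ b ↦ (η_p a)|_{W₀,σ} · (η_q b)|_{W₀,σ}`. [cite: StacksProject, Tag 0BEC] [cite: GortzWedhorn2020, Cor. 7.19 (4) and Prop. 7.24 (2)]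
[cite: GortzWedhorn2023, Def. 21.68 (p. 180)] -/
theorem exists_sysComplex_lexSystem_prodSystem_iso_cechComplex :
    ∃ e : sysComplex (lexSystem (prodSystem (sectionsSystem 𝓤 E (overRingHom iX φ)) (sectionsSystem 𝓥 F (overRingHom iY φ)))) ≅
        cechComplex (fun c : ι ×ₗ κ => p ⁻¹ᵁ 𝓤 (ofLex c).1 ⊓ q ⁻¹ᵁ 𝓥 (ofLex c).2) (boxTensor p q E F) (overRingHom (p ≫ iX) φ),
      ∀ (n : ℤ) (g : SysCochain (lexSystem (prodSystem (sectionsSystem 𝓤 E (overRingHom iX φ))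
          (sectionsSystem 𝓥 F (overRingHom iY φ)))) n) (σ : Simplex (ι ×ₗ κ) n),
        ((e.hom.f n).hom g) σ =
          SecMod.res (boxTensor p q E F) (overRingHom (p ≫ iX) φ) (le_of_eq (cechOpen_prodCover_eq p q 𝓤 𝓥 σ.1))
            ((boxTensorSecModEquiv H (hU _ (fstProj_nonempty_iff.2 σ.2.1)) (hV _ (sndProj_nonempty_iff.2 σ.2.1)) rfl hE hF φ).symm
              (g σ)) := by
  -- the characterised iso `lexSystem (boxSectionsSystem …) ≅ sectionsSystem W₀ …` of ★ `CechProductCoverLexSystem`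
  obtain ⟨e₂, he₂, he₂'⟩ := exists_lexSystem_boxSectionsSystem_iso_sectionsSystem p q 𝓤 𝓥 (boxTensor p q E F)
    (overRingHom (p ≫ iX) φ)
  -- componentwise isos on NON-EMPTY chains: `boxTensorSecModEquiv⁻¹` then `e₂`
  let e₁ : ∀ T : Finset (ι ×ₗ κ), T.Nonempty →
      ((lexSystem (prodSystem (sectionsSystem 𝓤 E (overRingHom iX φ)) (sectionsSystem 𝓥 F (overRingHom iY φ)))).obj T ≃ₗ[A]
        (sectionsSystem (fun c : ι ×ₗ κ => p ⁻¹ᵁ 𝓤 (ofLex c).1 ⊓ q ⁻¹ᵁ 𝓥 (ofLex c).2) (boxTensor p q E F)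
          (overRingHom (p ≫ iX) φ)).obj T) := fun T hT =>
    (boxTensorSecModEquiv H (hU _ (fstProj_nonempty_iff.2 hT)) (hV _ (sndProj_nonempty_iff.2 hT)) rfl hE hF φ).symm.trans
      (e₂.app T).toLinearEquiv
  have he₁ : ∀ (T T' : Finset (ι ×ₗ κ)) (hT : T.Nonempty) (hT' : T'.Nonempty) (h : T ⊆ T')
      (x : (lexSystem (prodSystem (sectionsSystem 𝓤 E (overRingHom iX φ)) (sectionsSystem 𝓥 F (overRingHom iY φ)))).obj T),
      e₁ T' hT' (((lexSystem (prodSystem (sectionsSystem 𝓤 E (overRingHom iX φ))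
          (sectionsSystem 𝓥 F (overRingHom iY φ)))).map (homOfLE h)).hom x) =
        ((sectionsSystem (fun c : ι ×ₗ κ => p ⁻¹ᵁ 𝓤 (ofLex c).1 ⊓ q ⁻¹ᵁ 𝓥 (ofLex c).2) (boxTensor p q E F)
          (overRingHom (p ≫ iX) φ)).map (homOfLE h)).hom (e₁ T hT x) := by
    intro T T' hT hT' h x
    change (e₂.hom.app T').hom ((boxTensorSecModEquiv H _ _ rfl hE hF φ).symm
        (((lexSystem (prodSystem (sectionsSystem 𝓤 E (overRingHom iX φ)) (sectionsSystem 𝓥 F (overRingHom iY φ)))).map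
          (homOfLE h)).hom x)) =
      SecMod.res _ _ _ ((e₂.hom.app T).hom ((boxTensorSecModEquiv H _ _ rfl hE hF φ).symm x))
    rw [he₂, he₂, SecMod.res_res]
    induction x using TensorProduct.induction_on with
    | zero => simp only [map_zero]
    | add x y hx hy => simp only [map_add, hx, hy]
    | tmul a b =>
      have key := boxTensorSecModEquiv_symm_natural 𝓤 𝓥 H hU hV hE hF φ (fstProj_nonempty_iff.2 hT)
        (fstProj_nonempty_iff.2 hT') (sndProj_nonempty_iff.2 hT) (sndProj_nonempty_iff.2 hT') (fstProj_mono h)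
        (sndProj_mono h) (a ⊗ₜ b)
      rw [TensorProduct.map_tmul] at key
      rw [lexSystem_prodSystem_map_tmul, sectionsSystem_map_apply, sectionsSystem_map_apply]
      erw [key]
      rw [SecMod.res_res]
  refine ⟨sysComplexIsoNE e₁ he₁, fun n g σ => ?_⟩
  rw [sysComplexIsoNE_hom_f_apply]
  exact he₂ σ.1 _

end Literature.AlgebraicGeometry.Modules

end
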